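import Literature.IUT.HodgeTheaters.FPrimeStripsMonoLaws
import HarnessLib

/-!
# [IUTchI] Corollary 5.3 (iii): reduction to the model case under the functoriality laws — proof-only companion

Mochizuki, *Inter-universal Teichmüller theory I*, kurims manuscript (May 2020), §5, Corollary 5.3
(iii), p. 144: *"For `i = 1, 2`, let `ⁱ𝔉^⊢` be an `ℱ^⊢`-prime-strip; `ⁱ𝔇^⊢` the `𝒟^⊢`-prime-strip
associated to `ⁱ𝔉^⊢` [cf. Remark 5.2.1, (i)].  Then the natural map `Isom(¹𝔉^⊢, ²𝔉^⊢) → Isom(¹𝔇^⊢, ²𝔇^⊢)`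
[cf. Remark 5.2.1, (i)] is surjective"*; proof p. 144: *"Assertion … (iii) follows immediately from
… [AbsTopIII], Proposition 5.8, (ii), (v)"* ([IUTchI] Cor 5.3 (iii) p.144) [claim: Mochizuki2012, status: disputed].
Node `IUTchI:Cor5.3(iii)`; statement = the named `Prop` `PMBaseKit.FKit.IsomFmtoDmSurjective` of
`FPrimeStrips.lean` (seat abc-iut-L5-t4).

WHAT IS PROVED.  Over the bare interface `FKit` the map `𝔉^⊢ ↦ 𝔇^⊢` on isomorphisms (`toDmMap`) is
opaque and Cor 5.3 (iii) admits no reduction (`FPrimeStripsRigidity.lean`, header).  Under the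
functoriality LAWS of Remark 5.2.1 (i) / Definition 4.1 (iv) — the hypothesis structure
`FKit.MonoLaws` of `FPrimeStripsMonoLaws.lean` ("functorial algorithm", "in a natural way") — it
does: `IsomFmtoDmSurjective` is EQUIVALENT to its MODEL CASE, the surjectivity of
`Isom(𝔉^⊢_mod, 𝔉^⊢_mod) → Isom(𝔇^⊢_mod, 𝔇^⊢_mod)` for the model `ℱ^⊢`-prime-strip `{ℱ^⊢_v}_{v∈𝕍}` of
Def 5.2 (ii) (`isomFmtoDmSurjective_iff_model`); the passage from the models to arbitrary isomorphs
is conjugation inside the groupoid of `𝒟^⊢`-prime-strips and is PROVED here, so that what remains is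
exactly the model case — the [AbsTopIII] Prop 5.8 (ii), (v) input of the printed proof, a hypothesis,
never asserted.  This is the `ℱ^⊢`-analogue of `FKit.isomFtoDBijective_iff_model` (Cor 5.3 (ii)).
No new definitions; no side taken on [IUTchIII] Cor. 3.12; typed ≠ discharged.
-/

namespace Literature.IUT.HodgeTheaters

open CategoryTheory

universe u

namespace PMBaseKit

namespace FKit

variable {l : ℕ} {K : PMBaseKit.{u} l} {M : K.MultKit} {FK : K.FKit M}

/-- Under the laws, `(𝔉^⊢ ↦ 𝔇^⊢)(φ⁻¹)` is the inverse of `(𝔉^⊢ ↦ 𝔇^⊢)(φ)` in the groupoid of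
`𝒟^⊢`-prime-strips. ([IUTchI] Rmk 5.2.1 (i) p.143) [claim: Mochizuki2012, status: disputed] -/
theorem MonoLaws.inv_toDmMap (L : FK.MonoLaws) {F₁ F₂ : ∀ v, FK.FmAmb v} (φ : ∀ v, F₁ v ≅ F₂ v) :
    inv (FK.toDmMap φ) = FK.toDmMap (fun v => (φ v).symm) :=
  IsIso.inv_eq_of_hom_inv_id (L.toDmMap_comp_symm φ)

/-- Conjugation to the models (the `ℱ^⊢`-analogue of `mapIso_bijective_of_model`): under the laws, if
`Isom(X, Y) → Isom(X^{𝒟^⊢}, Y^{𝒟^⊢})` is surjective for the MODEL collections `X = Y = {ℱ^⊢_v}`, it is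
surjective for any collections `X ≅ {ℱ^⊢_v} ≅ Y` (isomorphs). ([IUTchI] Cor 5.3 (iii) p.144) [claim: Mochizuki2012, status: disputed] -/
theorem MonoLaws.toDmMap_surjective_of_model (L : FK.MonoLaws)
    (h : Function.Surjective fun φ : (∀ v, FK.fmModel v ≅ FK.fmModel v) => FK.toDmMap φ)
    {X Y : ∀ v, FK.FmAmb v} (eX : ∀ v, X v ≅ FK.fmModel v) (eY : ∀ v, Y v ≅ FK.fmModel v) :
    Function.Surjective fun φ : (∀ v, X v ≅ Y v) => FK.toDmMap φ := by
  intro ψ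
  -- transport `ψ` to an endomorphism of the model `𝒟^⊢`-prime-strip
  obtain ⟨α, hα⟩ := h (FK.toDmMap (fun v => (eX v).symm) ≫ ψ ≫ FK.toDmMap eY)
  refine ⟨fun v => eX v ≪≫ α v ≪≫ (eY v).symm, ?_⟩
  have hα' : FK.toDmMap α = FK.toDmMap (fun v => (eX v).symm) ≫ ψ ≫ FK.toDmMap eY := hα
  show FK.toDmMap (fun v => eX v ≪≫ α v ≪≫ (eY v).symm) = ψ
  have e1 : (fun v => eX v ≪≫ α v ≪≫ (eY v).symm) =
      fun v => eX v ≪≫ (α v ≪≫ (eY v).symm) := rfl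
  rw [e1, L.toDmMap_trans eX (fun v => α v ≪≫ (eY v).symm), L.toDmMap_trans α (fun v => (eY v).symm),
    hα']
  simp only [Category.assoc]
  rw [L.toDmMap_comp_symm eY, Category.comp_id, ← Category.assoc, L.toDmMap_comp_symm eX,
    Category.id_comp]

/-- **Cor 5.3 (iii) from its model case, under the laws.**  If `Isom(𝔉^⊢_mod, 𝔉^⊢_mod) → Isom(𝔇^⊢, 𝔇^⊢)`
is surjective for the MODEL `ℱ^⊢`-prime-strip `{ℱ^⊢_v}_{v∈𝕍}`, then `Isom(¹𝔉^⊢, ²𝔉^⊢) → Isom(¹𝔇^⊢, ²𝔇^⊢)` is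
surjective for all `ℱ^⊢`-prime-strips, i.e. the named statement `IsomFmtoDmSurjective` holds.  (The
model case is where [AbsTopIII] Prop 5.8 (ii), (v) enters; the passage to isomorphs is the
functoriality of `𝔉^⊢ ↦ 𝔇^⊢`, Rmk 5.2.1 (i).) ([IUTchI] Cor 5.3 (iii) p.144) [claim: Mochizuki2012, status: disputed] -/
theorem MonoLaws.isomFmtoDmSurjective_of_model (L : FK.MonoLaws)
    (h : Function.Surjective fun φ : (∀ v, FK.fmModel v ≅ FK.fmModel v) => FK.toDmMap φ) :
    FK.IsomFmtoDmSurjective := fun F₁ F₂ =>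
  L.toDmMap_surjective_of_model h (fun v => (F₁.isModel v).some) (fun v => (F₂.isModel v).some)

/-- **The model case from Cor 5.3 (iii)** (no laws needed): `IsomFmtoDmSurjective` applied to the
model `ℱ^⊢`-prime-strip. ([IUTchI] Cor 5.3 (iii) p.144) [claim: Mochizuki2012, status: disputed] -/
theorem model_surjective_of_isomFmtoDmSurjective (h : FK.IsomFmtoDmSurjective) :
    Function.Surjective fun φ : (∀ v, FK.fmModel v ≅ FK.fmModel v) => FK.toDmMap φ :=
  h ⟨FK.fmModel, fun _ => ⟨Iso.refl _⟩⟩ ⟨FK.fmModel, fun _ => ⟨Iso.refl _⟩⟩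

/-- **Cor 5.3 (iii) is EQUIVALENT to its model case under the functoriality laws** of Rmk 5.2.1 (i):
the natural maps `Isom(¹𝔉^⊢, ²𝔉^⊢) → Isom(¹𝔇^⊢, ²𝔇^⊢)` are surjective for all `ℱ^⊢`-prime-strips iff the one
for the model strip `{ℱ^⊢_v}_{v∈𝕍}` of Examples 3.2 (v) / 3.3 (i) / 3.4 (ii) is — which isolates exactly
what the printed input [AbsTopIII] Prop 5.8 (ii), (v) must supply.
([IUTchI] Cor 5.3 (iii) p.144) [claim: Mochizuki2012, status: disputed] -/
theorem MonoLaws.isomFmtoDmSurjective_iff_model (L : FK.MonoLaws) :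
    FK.IsomFmtoDmSurjective ↔
      Function.Surjective fun φ : (∀ v, FK.fmModel v ≅ FK.fmModel v) => FK.toDmMap φ :=
  ⟨model_surjective_of_isomFmtoDmSurjective, L.isomFmtoDmSurjective_of_model⟩

end FKit

end PMBaseKit

end Literature.IUT.HodgeTheaters
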